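/-
Copyright (c) 2026 the pub-hodgecm-mathlib formalisation cell (harness21).  Prover seat hodgecm-mathlib-F0P2-p01 (g16): road «S3-ram» (LEAD F0P3a-plan (g13); owner F0P3a-p06),
(T2) G-side organ (Cnt2′) (chair F0P3a-p07 (g14∕g15) rulings (3)(6)(8)(13)), organ (z1-c) «TUBE LAYERS b ≥ 1» — (L2) «ANISOTROPIC ROOT PACKAGING» for F0P3a-p04 (g20)'s (K2-even); 2026-09-02.
-/
import Literature.NumberTheory.Automorphic.UnitaryLatticeTreeTubeCollarChildLaw          -- ★ p849149 (this seat): brings ★ Gate p848957, ★ TopLevel p848891 (K4), ★ CollarTokens p848616 (K0–K3), ★ TubeCone ∕ TubeAxisVertex ∕ TubeCoordinate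
import Literature.NumberTheory.Automorphic.UnitaryLatticeTreeAnisotropicBlockRootRegion    -- ★ p848920 (F0P3a-p08 (g20)): `axisVertex_eq_stdLattice_of_anisotropic` (the anisotropic block has ONE axis vertex); brings ★ `scaleLattice_one`
import HarnessLib

/-!
# The lattice graph of a hermitian space — ANISOTROPIC ROOT PACKAGING: every self-dual lattice two steps from the root of the anisotropic block `ι-shape(diag d, η)` is a
# COLLAR lattice of the root glued along a NON-AXIAL residually isotropic line, and its tokens are read on its value (Kottwitz 1986 §3; Rogawski 1990 §4.9; Bruhat–Tits 1972 §10)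

Topic `NumberTheory/Automorphic`; namespace `Literature.NumberTheory.Automorphic.UnitaryLatticeTree`.  THEOREMS ONLY (no definition, no instance, no notation, no named fact,
no `sorry`); kernel lane `--supports stmt-HodgeConjecture-24833`; datum-free (`K` with `Valued K ℤᵐ⁰`, `[IsPrincipalIdealRing 𝒪[K]]`).  Cell `pub/hodgecm-mathlib` (D-0151),
crux H413; road «S3-ram» (Literature seeding, count-neutral); (T2) G-side organ (Cnt2′) (chair F0P3a-p07 (g15) RULING (13)(5) «ANISOTROPIC ROOT COLLAR VALUES», layer
(L2) of F0P2-p01 (g16) 04:13:33Z, NAMED as input by F0P3a-p04 (g20) 04:30:56Z for «(K2-even) the A-even anisotropic root: all `(q+1)q` root grandchildren are `O_{mA}`»).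
CURRENCY = ★ `UnitaryLatticeTreeAnisotropicBlockRootRegion` (p848920): `H = !![(diagonal d) 0 0, 0, (diagonal d) 0 1; 0, η, 0; (diagonal d) 1 0, 0, (diagonal d) 1 1]` with `|d i| = |η| = 1`,
`σ d i = d i`, `σ η = η`, `diag d` RESIDUALLY ANISOTROPIC (`hanis₀`, `hanis₁`); root `L₀ = stdLattice K 3`; `Γ = ι(γ₁, u) = endoGL (γ₁, u)`; PARITY-FREE in the level `D ≥ 2`.

THE MATHEMATICS.  Let `w ≠ L₀` be self-dual with `ϖL₀ ≤ w` and `ϖw ≤ L₀` (the sandwich two steps out in the tree, ★ `scaleLattice_le_and_le_of_adj_of_isSelfDualLattice`).  Its tube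
coordinate is `b = 1`: `b ≤ 1` as `ϖe₁ ∈ ϖL₀ ⊆ w`, and `b = 0` would give `w = A(w) = L₀` (★ `axisVertex_eq_stdLattice_of_anisotropic`: the anisotropic block has ONE axis vertex).
So `w` has a generator `x₀` (`|x₀(1)| = |ϖ|⁻¹`) and `A(w) = L₀`; the vector `x := ϖx₀ ∈ L₀` is NON-AXIAL (`|x(1)| = 1`), residually ISOTROPIC (`|⟨x,x⟩| ≤ |ϖ|²`, `w` integral),
hence `x_W` is residually anisotropic-NONZERO (`|⟨x_W, x_W⟩_{diag d}| = |σ(x(1))ηx(1)| = 1`); and `w ⊇ c_x = {m ∈ L₀ : |⟨x, m⟩| ≤ |ϖ|}` (pair `m` with `w = (w ∩ W) + 𝒪x₀`,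
`w ∩ W ⊆ L₀ = L₀^#`).  This is (R1).  With `(Γ − 1)L₀ ⊆ ϖ^D L₀`, `D ≥ 2`, the COLLAR TOKENS ★ K0–K4 apply VERBATIM at `M := w`, `A(w) = L₀`, for ANY generator `x₀`: (R2) `Γw ⊆ w`,
`LEV[w](ϖ^{D−2})`, `LEV[w](ϖ^{D−1}) ⟺ |val| < 1` with `val = ϖ^{−D}⟨ϖx₀, (Γ−1)ϖx₀⟩`; (R3) the class law; (R4) `LEV[w](ϖ^D) ⟺ (Γ − u₀₀·1)(ϖx₀) ∈ ϖ^{D+1}L₀ ∧ |val| ≤ |ϖ|²` (★ K4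
with the `e₁`-part of the glued vector killed by `Γ − u₀₀·1`; needs `Γ` unitary).  The residual line `x̄` of `x = ϖx₀` is the child through which `w` hangs; different `w` below the
same child have `x ≡ a·x′ (mod ϖL₀)` and the same token (★ CHILD-LINE LAW `hanging_*`, p849149).

* §1 **`exists_generator_of_anisotropicRoot_sandwich`** (R1).
* §2 **`anisotropicRoot_fixed_and_lev_iff`** (R2), **`anisotropicRoot_class_iff`** (R3), **`anisotropicRoot_levTop_iff`** (R4).

HONEST LABEL: HC_CM is proved only modulo the 2 remaining named inputs (hLiu418 24832, h413 24833) until rung 0 closes; nothing printed is asserted here (elementary lattice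
algebra over a discretely valued field); «S3-ram» has no books consequence.

## References
* [Kottwitz1986] R. E. Kottwitz, *Base change for unit elements of Hecke algebras*, Compositio Math. 60 (1986), §3 (fixed lattices shell by shell).
* [Rogawski1990] J. D. Rogawski, *Automorphic Representations of Unitary Groups in Three Variables*, Ann. of Math. Stud. 123 (1990), §4.8 Case (a) p. 53, §4.9 p. 55.
* [BruhatTits1972] F. Bruhat, J. Tits, *Groupes réductifs sur un corps local I*, Publ. Math. IHÉS 41 (1972), §10 (lattice models; the anisotropic block has one axis vertex).
* [Serre1980Trees] J.-P. Serre, *Trees* (1980), Ch. II §1.1 (neighbours of a lattice).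
-/

set_option autoImplicit false

noncomputable section

open scoped Valued WithZero Matrix MatrixGroups

namespace Literature.NumberTheory.Automorphic.UnitaryLatticeTree

open Literature.NumberTheory.Automorphic Literature.NumberTheory.Automorphic.HermitianLattice Literature.NumberTheory.Rogawski1990

variable {K : Type*} [Field K] [Valued K ℤᵐ⁰]

/-! ## §1 (R1) Every self-dual lattice two steps from the anisotropic root is a collar lattice glued along a non-axial isotropic line -/

/-- **(R1) ANISOTROPIC ROOT PACKAGING.**  `w ≠ L₀` self-dual for `ι-shape(diag d, η)` with `ϖL₀ ≤ w`, `ϖw ≤ L₀`.  Then `w` has TUBE COORDINATE `1`, and for SOME generator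
`x₀ ∈ w` (`|x₀(1)|·|ϖ| = 1`): `x := ϖx₀ ∈ L₀`, `|x(1)| = 1` (non-axial), `|⟨x, x⟩| ≤ |ϖ|²` (residually isotropic), `|⟨x_W, x_W⟩_{diag d}| = 1` (residually anisotropic-nonzero
`W`-part), `c_x = {m ∈ L₀ : |⟨x,m⟩| ≤ |ϖ|} ⊆ w`, and `w ⊄ L₀` — the hypotheses of the ★ CHILD-LINE LAW at `v = L₀`. [cite: Kottwitz1986, §3] [cite: BruhatTits1972, §10] [cite: Serre1980Trees, II.1.1] -/
theorem exists_generator_of_anisotropicRoot_sandwich [IsPrincipalIdealRing 𝒪[K]] (σ : K →+* K) (hσ : ∀ a, σ (σ a) = a) (hvσ : ∀ a, Valued.v (σ a) = Valued.v a)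
    {ϖ : K} (hϖ : Valued.v ϖ = WithZero.exp (-1 : ℤ))
    {d : Fin 2 → K} (hd : ∀ i, Valued.v (d i) = 1) (hdσ : ∀ i, σ (d i) = d i)
    (hanis₀ : ∀ c : K, Valued.v c ≤ 1 → Valued.v (d 0 + d 1 * (σ c * c)) = 1)
    (hanis₁ : ∀ c : K, Valued.v c ≤ 1 → Valued.v (d 0 * (σ c * c) + d 1) = 1)
    {η : K} (hη : Valued.v η = 1) (hησ : σ η = η)
    {w : Submodule 𝒪[K] (Fin 3 → K)} (hw : IsSelfDualLattice σ ϖ (!![(Matrix.diagonal d) 0 0, 0, (Matrix.diagonal d) 0 1; 0, η, 0; (Matrix.diagonal d) 1 0, 0, (Matrix.diagonal d) 1 1] : Matrix (Fin 3) (Fin 3) K) w)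
    (hLw : scaleLattice (ϖ ^ 1) (stdLattice K 3) ≤ w) (hwL : scaleLattice (ϖ ^ 1) w ≤ stdLattice K 3) (hne : w ≠ stdLattice K 3) :
    (∀ c : K, (Pi.single 1 c : Fin 3 → K) ∈ w ↔ Valued.v c ≤ Valued.v ϖ ^ 1) ∧
      ∃ x₀ ∈ w, Valued.v (x₀ 1) * Valued.v ϖ ^ 1 = 1 ∧ ϖ • x₀ ∈ stdLattice K 3 ∧ Valued.v ((ϖ • x₀) 1) = 1 ∧
        Valued.v (pairing σ (!![(Matrix.diagonal d) 0 0, 0, (Matrix.diagonal d) 0 1; 0, η, 0; (Matrix.diagonal d) 1 0, 0, (Matrix.diagonal d) 1 1] : Matrix (Fin 3) (Fin 3) K) (ϖ • x₀) (ϖ • x₀)) ≤ Valued.v ϖ ^ 2 ∧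
        Valued.v (pairing σ (Matrix.diagonal d) (![(ϖ • x₀) 0, (ϖ • x₀) 2] : Fin 2 → K) ![(ϖ • x₀) 0, (ϖ • x₀) 2]) = 1 ∧
        (∀ m ∈ stdLattice K 3, Valued.v (pairing σ (!![(Matrix.diagonal d) 0 0, 0, (Matrix.diagonal d) 0 1; 0, η, 0; (Matrix.diagonal d) 1 0, 0, (Matrix.diagonal d) 1 1] : Matrix (Fin 3) (Fin 3) K) (ϖ • x₀) m) ≤ Valued.v ϖ → m ∈ w) ∧ ¬ w ≤ stdLattice K 3 := by
  have hϖ0' : Valued.v ϖ ≠ 0 := by rw [hϖ]; exact WithZero.exp_ne_zero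
  have hϖ0 : ϖ ≠ 0 := fun h0 => by rw [h0, map_zero] at hϖ0'; exact hϖ0' rfl
  have hϖlt : Valued.v ϖ < 1 := by rw [hϖ, ← WithZero.exp_zero, WithZero.exp_lt_exp]; omega
  have hϖ1 : Valued.v ϖ ≤ 1 := hϖlt.le
  have hϖ10 : ϖ ^ 1 ≠ 0 := pow_ne_zero _ hϖ0
  have hd0 : ∀ i, d i ≠ 0 := fun i h0 => by have h := hd i; rw [h0, map_zero] at h; exact zero_ne_one h
  have hH₂ : IsUnit (Matrix.diagonal d).det := by
    rw [Matrix.det_diagonal]; exact isUnit_iff_ne_zero.2 (Finset.prod_ne_zero_iff.2 fun i _ => hd0 i)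
  have hη0 : η ≠ 0 := fun h0 => by rw [h0, map_zero] at hη; exact zero_ne_one hη
  -- integrality
  have hL0 : IsSelfDualLattice σ ϖ (!![(Matrix.diagonal d) 0 0, 0, (Matrix.diagonal d) 0 1; 0, η, 0; (Matrix.diagonal d) 1 0, 0, (Matrix.diagonal d) 1 1] : Matrix (Fin 3) (Fin 3) K) (stdLattice K 3) := by
    have hHd : (!![(Matrix.diagonal d) 0 0, 0, (Matrix.diagonal d) 0 1; 0, η, 0; (Matrix.diagonal d) 1 0, 0, (Matrix.diagonal d) 1 1] : Matrix (Fin 3) (Fin 3) K) = Matrix.diagonal ![d 0, η, d 1] := by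
      ext i j; fin_cases i <;> fin_cases j <;> simp [Matrix.diagonal]
    have hd3 : ∀ i, Valued.v ((![d 0, η, d 1] : Fin 3 → K) i) = 1 := fun i => by fin_cases i <;> simp [hd, hη]
    rw [hHd]; exact isSelfDualLattice_stdLattice_diagonal σ hϖ1 hd3
  have hL0eq := dualLatt_eq_self_of_isSelfDualLattice hvσ (isUnit_det_endoShapeForm hH₂ hη) hL0
  have hweq := dualLatt_eq_self_of_isSelfDualLattice hvσ (isUnit_det_endoShapeForm hH₂ hη) hw
  have hL0d : ∀ a ∈ stdLattice K 3, ∀ b ∈ stdLattice K 3, Valued.v (pairing σ (!![(Matrix.diagonal d) 0 0, 0, (Matrix.diagonal d) 0 1; 0, η, 0; (Matrix.diagonal d) 1 0, 0, (Matrix.diagonal d) 1 1] : Matrix (Fin 3) (Fin 3) K) a b) ≤ 1 := fun a ha b hb =>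
    (mem_dualLatt σ _ _ b).1 (by rw [hL0eq]; exact hb) a ha
  have hwd : ∀ a ∈ w, ∀ b ∈ w, Valued.v (pairing σ (!![(Matrix.diagonal d) 0 0, 0, (Matrix.diagonal d) 0 1; 0, η, 0; (Matrix.diagonal d) 1 0, 0, (Matrix.diagonal d) 1 1] : Matrix (Fin 3) (Fin 3) K) a b) ≤ 1 := fun a ha b hb =>
    (mem_dualLatt σ _ _ b).1 (by rw [hweq]; exact hb) a ha
  -- the tube coordinate is `1`
  obtain ⟨b, hb, hpr, x₀, hx₀, hx₀1⟩ := exists_tubeCoordinate σ hvσ hϖ hH₂ hη hw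
  have hA := axisVertex_eq_stdLattice_of_anisotropic σ hσ hvσ hϖ hd hdσ hanis₀ hanis₁ hη hησ hw hb
  have hb_le : b ≤ 1 := by
    have h1 : (Pi.single 1 ϖ : Fin 3 → K) ∈ w := by
      refine hLw ((mem_scaleLattice_iff hϖ10 _ _).2 ?_)
      have e : (ϖ ^ 1)⁻¹ • (Pi.single 1 ϖ : Fin 3 → K) = Pi.single 1 1 := by
        ext k; rcases eq_or_ne k 1 with rfl | hk
        · simp [hϖ0]
        · simp [hk]
      rw [e, mem_stdLattice]; intro i; rcases eq_or_ne i 1 with rfl | hi <;> simp [*]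
    have h2 := (hb ϖ).1 h1
    rw [← pow_one (Valued.v ϖ)] at h2
    exact (v_pow_le_v_pow_iff hϖ 1 b).1 (by rw [pow_one]; rw [pow_one] at h2; exact h2)
  have hb_ge : 1 ≤ b := by
    by_contra hlt
    have hb0 : b = 0 := by omega
    subst hb0
    apply hne
    -- `e₁ ∈ w`, so `w ≤ A(w) = L₀`, and both are self-dual
    have hwA : w ≤ stdLattice K 3 := by
      rw [← hA, pow_zero, scaleLattice_one]
      exact le_sup_right.trans le_sup_left
    refine le_antisymm hwA ?_
    rw [← hL0eq, ← hweq]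
    exact dualLatt_antitone σ _ hwA
  obtain rfl : b = 1 := le_antisymm hb_le hb_ge
  -- the generator and `x := ϖ x₀`
  have hx₀10 : x₀ 1 ≠ 0 := fun h0 => by rw [h0, map_zero, zero_mul] at hx₀1; exact zero_ne_one hx₀1
  have hx₀v : Valued.v (x₀ 1) = (Valued.v ϖ ^ 1)⁻¹ := eq_inv_of_mul_eq_one_left hx₀1
  have hmax : ∀ m ∈ w, Valued.v (m 1) ≤ Valued.v (x₀ 1) := fun m hm => by
    rw [hx₀v, ← one_mul (Valued.v ϖ ^ 1)⁻¹, le_mul_inv_iff₀ (zero_lt_iff.2 (pow_ne_zero _ hϖ0'))]; exact hpr m hm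
  have hxL : ϖ • x₀ ∈ stdLattice K 3 := hwL ((mem_scaleLattice_iff hϖ10 _ _).2 (by rw [pow_one, smul_smul, inv_mul_cancel₀ hϖ0, one_smul]; exact hx₀))
  have hx1 : Valued.v ((ϖ • x₀) 1) = 1 := by rw [Pi.smul_apply, smul_eq_mul, map_mul, mul_comm, ← pow_one (Valued.v ϖ), hx₀1]
  have hnle : ¬ w ≤ stdLattice K 3 := fun hle => by
    have h1 := (mem_stdLattice.1 (hle hx₀)) 1
    rw [hx₀v, pow_one, inv_le_one₀ (zero_lt_iff.2 hϖ0')] at h1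
    exact absurd h1 (not_le.2 hϖlt)
  -- residual isotropy of `x` and anisotropy of `x_W`
  have hiso : Valued.v (pairing σ (!![(Matrix.diagonal d) 0 0, 0, (Matrix.diagonal d) 0 1; 0, η, 0; (Matrix.diagonal d) 1 0, 0, (Matrix.diagonal d) 1 1] : Matrix (Fin 3) (Fin 3) K) (ϖ • x₀) (ϖ • x₀)) ≤ Valued.v ϖ ^ 2 := by
    simp only [map_smulₛₗ, LinearMap.smul_apply, smul_eq_mul, RingHom.id_apply, map_mul, hvσ]
    rw [pow_two]
    exact mul_le_mul' le_rfl ((mul_le_mul' le_rfl (hwd x₀ hx₀ x₀ hx₀)).trans (le_of_eq (mul_one _)))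
  have hWunit : Valued.v (pairing σ (Matrix.diagonal d) (![(ϖ • x₀) 0, (ϖ • x₀) 2] : Fin 2 → K) ![(ϖ • x₀) 0, (ϖ • x₀) 2]) = 1 := by
    have e := pairing_endoShape_apply σ (Matrix.diagonal d) η (ϖ • x₀) (ϖ • x₀)
    have e' : pairing σ (Matrix.diagonal d) (![(ϖ • x₀) 0, (ϖ • x₀) 2] : Fin 2 → K) ![(ϖ • x₀) 0, (ϖ • x₀) 2] =
        -(σ ((ϖ • x₀) 1) * η * (ϖ • x₀) 1) + pairing σ (!![(Matrix.diagonal d) 0 0, 0, (Matrix.diagonal d) 0 1; 0, η, 0; (Matrix.diagonal d) 1 0, 0, (Matrix.diagonal d) 1 1] : Matrix (Fin 3) (Fin 3) K) (ϖ • x₀) (ϖ • x₀) := by rw [e]; ring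
    have hu : Valued.v (-(σ ((ϖ • x₀) 1) * η * (ϖ • x₀) 1)) = 1 := by rw [Valuation.map_neg, map_mul, map_mul, hvσ, hx1, hη, one_mul, one_mul]
    rw [e', Valuation.map_add_eq_of_lt_left _ (by rw [hu]; exact lt_of_le_of_lt hiso (by rw [pow_two]; exact mul_lt_one_of_nonneg_of_lt_one_left zero_le hϖlt hϖ1)), hu]
  -- `c_x ⊆ w`
  have hcx : ∀ m ∈ stdLattice K 3, Valued.v (pairing σ (!![(Matrix.diagonal d) 0 0, 0, (Matrix.diagonal d) 0 1; 0, η, 0; (Matrix.diagonal d) 1 0, 0, (Matrix.diagonal d) 1 1] : Matrix (Fin 3) (Fin 3) K) (ϖ • x₀) m) ≤ Valued.v ϖ → m ∈ w := by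
    intro m hm hxm
    rw [← hweq, mem_dualLatt]
    intro y hy
    obtain ⟨t, ht, hty, hty1⟩ := (mem_iff_exists_sub_smul_mem_of_coord_le 1 hx₀ hx₀10 hmax y).1 hy
    have hyWL : y - t • x₀ ∈ stdLattice K 3 := by
      rw [← hA]
      exact Submodule.mem_sup_left (Submodule.mem_sup_left ⟨hty, (mem_kerProj_one_iff _).2 hty1⟩)
    have e : y = (y - t • x₀) + (t * ϖ⁻¹) • (ϖ • x₀) := by rw [smul_smul, mul_assoc, inv_mul_cancel₀ hϖ0, mul_one, sub_add_cancel]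
    rw [e, LinearMap.map_add, LinearMap.add_apply, LinearMap.map_smulₛₗ, LinearMap.smul_apply, smul_eq_mul]
    refine (Valuation.map_add _ _ _).trans (max_le (hL0d _ hyWL m hm) ?_)
    rw [map_mul, hvσ, map_mul, map_inv₀, mul_assoc]
    refine mul_le_one' ht ?_
    rw [inv_mul_le_iff₀ (zero_lt_iff.2 hϖ0'), mul_one]; exact hxm
  exact ⟨hb, x₀, hx₀, hx₀1, hxL, hx1, hiso, hWunit, hcx, hnle⟩

/-! ## §2 (R2)–(R4) The collar tokens at the anisotropic root, for ANY generator -/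

/-- **(R2) TOKENS AT THE ANISOTROPIC ROOT (fixedness, levels).**  `w` as in (R1), `x₀ ∈ w` ANY generator (`|x₀(1)|·|ϖ| = 1`), `(Γ − 1)L₀ ⊆ ϖ^D L₀`, `D ≥ 2`.  Then `Γw ⊆ w`,
`LEV[w](ϖ^{D−2})`, and `LEV[w](ϖ^{D−1}) ⟺ |ϖ^{−D}⟨ϖx₀, (Γ−1)ϖx₀⟩| < 1` (★ K0–K2 `collar_fixed_and_lev_of_axisLevel` with `A(w) = L₀`). [cite: Kottwitz1986, §3] [cite: Rogawski1990, §4.9 p. 55] -/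
theorem anisotropicRoot_fixed_and_lev_iff [IsPrincipalIdealRing 𝒪[K]] (σ : K →+* K) (hσ : ∀ a, σ (σ a) = a) (hvσ : ∀ a, Valued.v (σ a) = Valued.v a)
    {ϖ : K} (hϖ : Valued.v ϖ = WithZero.exp (-1 : ℤ))
    {d : Fin 2 → K} (hd : ∀ i, Valued.v (d i) = 1) (hdσ : ∀ i, σ (d i) = d i)
    (hanis₀ : ∀ c : K, Valued.v c ≤ 1 → Valued.v (d 0 + d 1 * (σ c * c)) = 1)
    (hanis₁ : ∀ c : K, Valued.v c ≤ 1 → Valued.v (d 0 * (σ c * c) + d 1) = 1)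
    {η : K} (hη : Valued.v η = 1) (hησ : σ η = η)
    (γ₁ : GL (Fin 2) K) (u : GL (Fin 1) K) {D : ℕ} (hD : 2 ≤ D)
    (hlev : ∀ a ∈ stdLattice K 3, (((endoGL (γ₁, u) : GL (Fin 3) K) : Matrix (Fin 3) (Fin 3) K) - 1) *ᵥ a ∈ scaleLattice (ϖ ^ D) (stdLattice K 3))
    {w : Submodule 𝒪[K] (Fin 3 → K)} (hw : IsSelfDualLattice σ ϖ (!![(Matrix.diagonal d) 0 0, 0, (Matrix.diagonal d) 0 1; 0, η, 0; (Matrix.diagonal d) 1 0, 0, (Matrix.diagonal d) 1 1] : Matrix (Fin 3) (Fin 3) K) w)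
    (hLw : scaleLattice (ϖ ^ 1) (stdLattice K 3) ≤ w) (hwL : scaleLattice (ϖ ^ 1) w ≤ stdLattice K 3) (hne : w ≠ stdLattice K 3) {x₀ : Fin 3 → K} (hx₀ : x₀ ∈ w) (hx₀1 : Valued.v (x₀ 1) * Valued.v ϖ ^ 1 = 1) :
    mapGL (endoGL (γ₁, u)) w ≤ w ∧
    (∀ y ∈ w, (((endoGL (γ₁, u) : GL (Fin 3) K) : Matrix (Fin 3) (Fin 3) K) - 1) *ᵥ y ∈ scaleLattice (ϖ ^ (D - 2)) w) ∧
    ((∀ y ∈ w, (((endoGL (γ₁, u) : GL (Fin 3) K) : Matrix (Fin 3) (Fin 3) K) - 1) *ᵥ y ∈ scaleLattice (ϖ ^ (D - 1)) w) ↔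
      Valued.v ((ϖ ^ D)⁻¹ * pairing σ (!![(Matrix.diagonal d) 0 0, 0, (Matrix.diagonal d) 0 1; 0, η, 0; (Matrix.diagonal d) 1 0, 0, (Matrix.diagonal d) 1 1] : Matrix (Fin 3) (Fin 3) K) (ϖ • x₀) ((((endoGL (γ₁, u) : GL (Fin 3) K) : Matrix (Fin 3) (Fin 3) K) - 1) *ᵥ (ϖ • x₀))) < 1) := by
  have hd0 : ∀ i, d i ≠ 0 := fun i h0 => by have h := hd i; rw [h0, map_zero] at h; exact zero_ne_one h
  have hH₂ : IsUnit (Matrix.diagonal d).det := by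
    rw [Matrix.det_diagonal]; exact isUnit_iff_ne_zero.2 (Finset.prod_ne_zero_iff.2 fun i _ => hd0 i)
  have hH₂σ : ((Matrix.diagonal d).map σ)ᵀ = Matrix.diagonal d := by
    rw [Matrix.diagonal_map (map_zero σ), Matrix.diagonal_transpose]; exact congrArg Matrix.diagonal (funext hdσ)
  obtain ⟨hb, -⟩ := exists_generator_of_anisotropicRoot_sandwich σ hσ hvσ hϖ hd hdσ hanis₀ hanis₁ hη hησ hw hLw hwL hne
  have hA := axisVertex_eq_stdLattice_of_anisotropic σ hσ hvσ hϖ hd hdσ hanis₀ hanis₁ hη hησ hw hb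
  have hAlev : ∀ a ∈ w ⊓ LinearMap.ker ((LinearMap.proj (1 : Fin 3) : (Fin 3 → K) →ₗ[K] K).restrictScalars 𝒪[K]) ⊔ scaleLattice (ϖ ^ 1) w ⊔ Submodule.span 𝒪[K] {(Pi.single 1 1 : Fin 3 → K)}, (((endoGL (γ₁, u) : GL (Fin 3) K) : Matrix (Fin 3) (Fin 3) K) - 1) *ᵥ a ∈ scaleLattice (ϖ ^ D) (w ⊓ LinearMap.ker ((LinearMap.proj (1 : Fin 3) : (Fin 3 → K) →ₗ[K] K).restrictScalars 𝒪[K]) ⊔ scaleLattice (ϖ ^ 1) w ⊔ Submodule.span 𝒪[K] {(Pi.single 1 1 : Fin 3 → K)}) := by rw [hA]; exact hlev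
  exact collar_fixed_and_lev_of_axisLevel σ hσ hvσ hϖ hH₂ hH₂σ hη hησ hw hb hx₀ hx₀1 γ₁ u hD hAlev

/-- **(R3) TOKENS AT THE ANISOTROPIC ROOT (class).**  In the situation of (R2), if the value `val = ϖ^{−D}⟨ϖx₀, (Γ−1)ϖx₀⟩` is a UNIT, the depth-`(D−2)` value form of `w`
represents the unit class of `c₀` iff `−val` lies in it (★ K3 `collar_class_iff_of_axisLevel` with `A(w) = L₀`). [cite: Kottwitz1986, §3] [cite: Rogawski1990, §4.9 p. 55] -/
theorem anisotropicRoot_class_iff [IsPrincipalIdealRing 𝒪[K]] (σ : K →+* K) (hσ : ∀ a, σ (σ a) = a) (hvσ : ∀ a, Valued.v (σ a) = Valued.v a)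
    {ϖ : K} (hϖ : Valued.v ϖ = WithZero.exp (-1 : ℤ))
    {d : Fin 2 → K} (hd : ∀ i, Valued.v (d i) = 1) (hdσ : ∀ i, σ (d i) = d i)
    (hanis₀ : ∀ c : K, Valued.v c ≤ 1 → Valued.v (d 0 + d 1 * (σ c * c)) = 1)
    (hanis₁ : ∀ c : K, Valued.v c ≤ 1 → Valued.v (d 0 * (σ c * c) + d 1) = 1)
    {η : K} (hη : Valued.v η = 1) (hησ : σ η = η)
    (hres : ∀ z : K, Valued.v z ≤ 1 → Valued.v (σ z - z) < 1) (hσϖ : σ ϖ = -ϖ)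
    (γ₁ : GL (Fin 2) K) (u : GL (Fin 1) K) {D : ℕ} (hD : 2 ≤ D)
    (hlev : ∀ a ∈ stdLattice K 3, (((endoGL (γ₁, u) : GL (Fin 3) K) : Matrix (Fin 3) (Fin 3) K) - 1) *ᵥ a ∈ scaleLattice (ϖ ^ D) (stdLattice K 3))
    {w : Submodule 𝒪[K] (Fin 3 → K)} (hw : IsSelfDualLattice σ ϖ (!![(Matrix.diagonal d) 0 0, 0, (Matrix.diagonal d) 0 1; 0, η, 0; (Matrix.diagonal d) 1 0, 0, (Matrix.diagonal d) 1 1] : Matrix (Fin 3) (Fin 3) K) w)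
    (hLw : scaleLattice (ϖ ^ 1) (stdLattice K 3) ≤ w) (hwL : scaleLattice (ϖ ^ 1) w ≤ stdLattice K 3) (hne : w ≠ stdLattice K 3) {x₀ : Fin 3 → K} (hx₀ : x₀ ∈ w) (hx₀1 : Valued.v (x₀ 1) * Valued.v ϖ ^ 1 = 1)
    (hunit : Valued.v ((ϖ ^ D)⁻¹ * pairing σ (!![(Matrix.diagonal d) 0 0, 0, (Matrix.diagonal d) 0 1; 0, η, 0; (Matrix.diagonal d) 1 0, 0, (Matrix.diagonal d) 1 1] : Matrix (Fin 3) (Fin 3) K) (ϖ • x₀) ((((endoGL (γ₁, u) : GL (Fin 3) K) : Matrix (Fin 3) (Fin 3) K) - 1) *ᵥ (ϖ • x₀))) = 1) {c₀ : K} (hc₀ : Valued.v c₀ = 1) :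
    (∃ y ∈ w, ∃ a : K, Valued.v a = 1 ∧ Valued.v ((ϖ ^ (D - 2))⁻¹ * pairing σ (!![(Matrix.diagonal d) 0 0, 0, (Matrix.diagonal d) 0 1; 0, η, 0; (Matrix.diagonal d) 1 0, 0, (Matrix.diagonal d) 1 1] : Matrix (Fin 3) (Fin 3) K) y ((((endoGL (γ₁, u) : GL (Fin 3) K) : Matrix (Fin 3) (Fin 3) K) - 1) *ᵥ y) - c₀ * a ^ 2) < 1) ↔
      ∃ a : K, Valued.v a = 1 ∧ Valued.v ((ϖ ^ D)⁻¹ * pairing σ (!![(Matrix.diagonal d) 0 0, 0, (Matrix.diagonal d) 0 1; 0, η, 0; (Matrix.diagonal d) 1 0, 0, (Matrix.diagonal d) 1 1] : Matrix (Fin 3) (Fin 3) K) (ϖ • x₀) ((((endoGL (γ₁, u) : GL (Fin 3) K) : Matrix (Fin 3) (Fin 3) K) - 1) *ᵥ (ϖ • x₀)) + c₀ * a ^ 2) < 1 := by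
  have hd0 : ∀ i, d i ≠ 0 := fun i h0 => by have h := hd i; rw [h0, map_zero] at h; exact zero_ne_one h
  have hH₂ : IsUnit (Matrix.diagonal d).det := by
    rw [Matrix.det_diagonal]; exact isUnit_iff_ne_zero.2 (Finset.prod_ne_zero_iff.2 fun i _ => hd0 i)
  have hH₂σ : ((Matrix.diagonal d).map σ)ᵀ = Matrix.diagonal d := by
    rw [Matrix.diagonal_map (map_zero σ), Matrix.diagonal_transpose]; exact congrArg Matrix.diagonal (funext hdσ)
  obtain ⟨hb, -⟩ := exists_generator_of_anisotropicRoot_sandwich σ hσ hvσ hϖ hd hdσ hanis₀ hanis₁ hη hησ hw hLw hwL hne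
  have hA := axisVertex_eq_stdLattice_of_anisotropic σ hσ hvσ hϖ hd hdσ hanis₀ hanis₁ hη hησ hw hb
  have hAlev : ∀ a ∈ w ⊓ LinearMap.ker ((LinearMap.proj (1 : Fin 3) : (Fin 3 → K) →ₗ[K] K).restrictScalars 𝒪[K]) ⊔ scaleLattice (ϖ ^ 1) w ⊔ Submodule.span 𝒪[K] {(Pi.single 1 1 : Fin 3 → K)}, (((endoGL (γ₁, u) : GL (Fin 3) K) : Matrix (Fin 3) (Fin 3) K) - 1) *ᵥ a ∈ scaleLattice (ϖ ^ D) (w ⊓ LinearMap.ker ((LinearMap.proj (1 : Fin 3) : (Fin 3 → K) →ₗ[K] K).restrictScalars 𝒪[K]) ⊔ scaleLattice (ϖ ^ 1) w ⊔ Submodule.span 𝒪[K] {(Pi.single 1 1 : Fin 3 → K)}) := by rw [hA]; exact hlev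
  exact collar_class_iff_of_axisLevel σ hσ hvσ hres hϖ hσϖ hH₂ hH₂σ hη hησ hw hb hx₀ hx₀1 γ₁ u hD hAlev hunit hc₀

/-- **(R4) TOKENS AT THE ANISOTROPIC ROOT (top level).**  In the situation of (R2) with `Γ` UNITARY: `LEV[w](ϖ^D) ⟺ (Γ − u₀₀·1)(ϖx₀) ∈ ϖ^{D+1}L₀ ∧ |val| ≤ |ϖ|²`
(★ K4 `collar_levTop_iff_of_axisLevel` with `A(w) = L₀`; `Γ − u₀₀·1` kills the `e₁`-part of the glued vector). So `w` is a region member only if `x̄ = ϖx₀ mod ϖ` spans an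
EIGENLINE of `ϖ^{−D}(γ₁ − 1) mod ϖ` for the eigenvalue `ϖ^{−D}(u₀₀ − 1)`. [cite: Kottwitz1986, §3] [cite: Rogawski1990, §4.9 p. 55] -/
theorem anisotropicRoot_levTop_iff [IsPrincipalIdealRing 𝒪[K]] (σ : K →+* K) (hσ : ∀ a, σ (σ a) = a) (hvσ : ∀ a, Valued.v (σ a) = Valued.v a)
    {ϖ : K} (hϖ : Valued.v ϖ = WithZero.exp (-1 : ℤ))
    {d : Fin 2 → K} (hd : ∀ i, Valued.v (d i) = 1) (hdσ : ∀ i, σ (d i) = d i)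
    (hanis₀ : ∀ c : K, Valued.v c ≤ 1 → Valued.v (d 0 + d 1 * (σ c * c)) = 1)
    (hanis₁ : ∀ c : K, Valued.v c ≤ 1 → Valued.v (d 0 * (σ c * c) + d 1) = 1)
    {η : K} (hη : Valued.v η = 1) (hησ : σ η = η)
    (γ₁ : GL (Fin 2) K) (u : GL (Fin 1) K) (hΓU : endoGL (γ₁, u) ∈ unitaryGroupOfForm σ (!![(Matrix.diagonal d) 0 0, 0, (Matrix.diagonal d) 0 1; 0, η, 0; (Matrix.diagonal d) 1 0, 0, (Matrix.diagonal d) 1 1] : Matrix (Fin 3) (Fin 3) K)) {D : ℕ} (hD : 2 ≤ D)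
    (hlev : ∀ a ∈ stdLattice K 3, (((endoGL (γ₁, u) : GL (Fin 3) K) : Matrix (Fin 3) (Fin 3) K) - 1) *ᵥ a ∈ scaleLattice (ϖ ^ D) (stdLattice K 3))
    {w : Submodule 𝒪[K] (Fin 3 → K)} (hw : IsSelfDualLattice σ ϖ (!![(Matrix.diagonal d) 0 0, 0, (Matrix.diagonal d) 0 1; 0, η, 0; (Matrix.diagonal d) 1 0, 0, (Matrix.diagonal d) 1 1] : Matrix (Fin 3) (Fin 3) K) w)
    (hLw : scaleLattice (ϖ ^ 1) (stdLattice K 3) ≤ w) (hwL : scaleLattice (ϖ ^ 1) w ≤ stdLattice K 3) (hne : w ≠ stdLattice K 3) {x₀ : Fin 3 → K} (hx₀ : x₀ ∈ w) (hx₀1 : Valued.v (x₀ 1) * Valued.v ϖ ^ 1 = 1) :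
    (∀ y ∈ w, (((endoGL (γ₁, u) : GL (Fin 3) K) : Matrix (Fin 3) (Fin 3) K) - 1) *ᵥ y ∈ scaleLattice (ϖ ^ D) w) ↔
      ((((endoGL (γ₁, u) : GL (Fin 3) K) : Matrix (Fin 3) (Fin 3) K) - (u : Matrix (Fin 1) (Fin 1) K) 0 0 • (1 : Matrix (Fin 3) (Fin 3) K)) *ᵥ (ϖ • x₀) ∈ scaleLattice (ϖ ^ (D + 1)) (stdLattice K 3) ∧
        Valued.v ((ϖ ^ D)⁻¹ * pairing σ (!![(Matrix.diagonal d) 0 0, 0, (Matrix.diagonal d) 0 1; 0, η, 0; (Matrix.diagonal d) 1 0, 0, (Matrix.diagonal d) 1 1] : Matrix (Fin 3) (Fin 3) K) (ϖ • x₀) ((((endoGL (γ₁, u) : GL (Fin 3) K) : Matrix (Fin 3) (Fin 3) K) - 1) *ᵥ (ϖ • x₀))) ≤ Valued.v ϖ ^ 2) := by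
  have hd0 : ∀ i, d i ≠ 0 := fun i h0 => by have h := hd i; rw [h0, map_zero] at h; exact zero_ne_one h
  have hH₂ : IsUnit (Matrix.diagonal d).det := by
    rw [Matrix.det_diagonal]; exact isUnit_iff_ne_zero.2 (Finset.prod_ne_zero_iff.2 fun i _ => hd0 i)
  have hH₂σ : ((Matrix.diagonal d).map σ)ᵀ = Matrix.diagonal d := by
    rw [Matrix.diagonal_map (map_zero σ), Matrix.diagonal_transpose]; exact congrArg Matrix.diagonal (funext hdσ)
  have hY11 := endoGL_sub_one_apply_one_one γ₁ u
  have hYu := endoGL_sub_one_sub_smul_one γ₁ u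
  have hYcol := endoGL_sub_one_col γ₁ u
  obtain ⟨hb, -⟩ := exists_generator_of_anisotropicRoot_sandwich σ hσ hvσ hϖ hd hdσ hanis₀ hanis₁ hη hησ hw hLw hwL hne
  have hA := axisVertex_eq_stdLattice_of_anisotropic σ hσ hvσ hϖ hd hdσ hanis₀ hanis₁ hη hησ hw hb
  have hAlev : ∀ a ∈ w ⊓ LinearMap.ker ((LinearMap.proj (1 : Fin 3) : (Fin 3 → K) →ₗ[K] K).restrictScalars 𝒪[K]) ⊔ scaleLattice (ϖ ^ 1) w ⊔ Submodule.span 𝒪[K] {(Pi.single 1 1 : Fin 3 → K)}, (((endoGL (γ₁, u) : GL (Fin 3) K) : Matrix (Fin 3) (Fin 3) K) - 1) *ᵥ a ∈ scaleLattice (ϖ ^ D) (w ⊓ LinearMap.ker ((LinearMap.proj (1 : Fin 3) : (Fin 3 → K) →ₗ[K] K).restrictScalars 𝒪[K]) ⊔ scaleLattice (ϖ ^ 1) w ⊔ Submodule.span 𝒪[K] {(Pi.single 1 1 : Fin 3 → K)}) := by rw [hA]; exact hlev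
  rw [collar_levTop_iff_of_axisLevel σ hσ hvσ hϖ hH₂ hH₂σ hη hησ hw hb hx₀ hx₀1 γ₁ u hΓU hD hAlev, hA]
  -- `(Γ − u•1)` kills `e₁`-multiples: the glued vector and `ϖx₀` have the same image
  have hScol : ∀ l : Fin 3, l ≠ 1 → (((endoGL (γ₁, u) : GL (Fin 3) K) : Matrix (Fin 3) (Fin 3) K) - (u : Matrix (Fin 1) (Fin 1) K) 0 0 • (1 : Matrix (Fin 3) (Fin 3) K)) l 1 = 0 := fun l hl => by
    rw [← hYu, Matrix.sub_apply, hYcol l hl, Matrix.smul_apply, Matrix.one_apply_ne hl, smul_zero, sub_zero]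
  have hS11 : (((endoGL (γ₁, u) : GL (Fin 3) K) : Matrix (Fin 3) (Fin 3) K) - (u : Matrix (Fin 1) (Fin 1) K) 0 0 • (1 : Matrix (Fin 3) (Fin 3) K)) 1 1 = 0 := by
    rw [← hYu, Matrix.sub_apply, hY11, Matrix.smul_apply, Matrix.one_apply_eq, smul_eq_mul, mul_one, sub_self]
  have hSe : ∀ c : K, (((endoGL (γ₁, u) : GL (Fin 3) K) : Matrix (Fin 3) (Fin 3) K) - (u : Matrix (Fin 1) (Fin 1) K) 0 0 • (1 : Matrix (Fin 3) (Fin 3) K)) *ᵥ (Pi.single 1 c : Fin 3 → K) = 0 := fun c => by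
    rw [mulVec_single_one_of_block hScol, hS11, zero_mul, Pi.single_zero]
  have hz₀ : ((ϖ ^ 1) • (x₀ - Pi.single 1 (x₀ 1)) : Fin 3 → K) = ϖ • x₀ - Pi.single 1 (ϖ * x₀ 1) := by
    rw [pow_one, smul_sub]
    congr 1
    ext k; rcases eq_or_ne k 1 with rfl | hk <;> simp [*]
  rw [hz₀, Matrix.mulVec_sub, hSe, sub_zero]

end Literature.NumberTheory.Automorphic.UnitaryLatticeTree

end
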